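import Mathlib.Topology.UniformSpace.HeineCantor
import Literature.Probability.Process.SimpleProcessAlgebra
import HarnessLib

/-!
# Construction of the Itô integral, I: dyadic sampling of continuous adapted integrands

The canonical approximating sequence of a path-continuous adapted integrand `σ` by bounded
simple processes: sample `σ` at the dyadic grid `k / 2ⁿ`, `k ≤ n 2ⁿ`, and clamp the values to
`[-n, n]` (`SimpleProcess.sample σ hσ n`). This file is deterministic/pathwise:

* `Literature.dyadicTimes n` — the grid as a strictly increasing `List ℝ≥0`;
* `Literature.clamp C x = max (-C) (min C x)`;
* `Literature.Probability.Process.SimpleProcess.sample` — the sampled simple process (adapted because the value on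
  `(k/2ⁿ, (k+1)/2ⁿ]` is `σ_{k/2ⁿ}` clamped);
* `Literature.Probability.Process.SimpleProcess.toProcess_eq_value_of_mem_Ioc` — a step process equals its `k`-th value on
  the `k`-th partition interval; `Literature.Probability.Process.SimpleProcess.measurable_toProcess_prod` — joint
  measurability of `(ω, s) ↦ H(s⁺, ω)` (the path version is `measurable_toProcess_path` of
  `ItoProcesses.lean`, not duplicated here);
* `Literature.sampleLeft n s = (⌈s 2ⁿ⌉ - 1) / 2ⁿ` — the left end of the (left-open) dyadic cell
  `(k/2ⁿ, (k+1)/2ⁿ]` containing `s > 0`;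
* `Literature.Probability.Process.SimpleProcess.tendsto_lintegral_sample_sub_sq` — **pathwise approximation**: if
  `s ↦ σ s ω` is continuous then `∫₀ᵗ (σₙ(s⁺, ω) - σ(s⁺, ω))² ds → 0`, where `σₙ` is the `n`-th
  sampled process (uniform continuity on `[0, t]`).

The probabilistic consequences (approximation in probability, u.c.p. limits, the Itô integral of
a continuous adapted integrand) are in `ItoIntegralConstructionLimit`.

## References

* D. Revuz, M. Yor, *Continuous Martingales and Brownian Motion* (3rd ed., 1999), Ch. IV,
  Prop. (2.13) (Riemann sums `∑ K_{tᵢ} (X_{tᵢ₊₁} - X_{tᵢ})` of a left-continuous locally bounded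
  `K` along subdivisions with mesh `→ 0` converge in probability to `∫ K dX`) and its proof
  ("the elementary processes `∑ K_{tᵢ} 1_{]tᵢ, tᵢ₊₁]}` converge pointwise to `K`").
-/

open MeasureTheory Filter Finset
open scoped NNReal ENNReal Topology

noncomputable section

namespace Literature.Probability.Process

variable {Ω : Type*} {m : MeasurableSpace Ω} {𝓕 : Filtration ℝ≥0 m}

/-! ### The dyadic grid -/

/-- The dyadic grid of mesh `2⁻ⁿ` on `[0, n]`: the list of the times `k / 2ⁿ`, `k = 0, …, n 2ⁿ`.
Revuz–Yor, *Continuous Martingales and Brownian Motion* (1999), Ch. IV, Prop. (2.13)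
(subdivisions `Δⁿ` with `|Δⁿ| → 0`). [folklore] -/
def dyadicTimes (n : ℕ) : List ℝ≥0 :=
  (List.range (n * 2 ^ n + 1)).map fun k : ℕ ↦ (k : ℝ≥0) / 2 ^ n

/-- The dyadic grid has `n 2ⁿ + 1` points. [folklore] -/
@[simp] theorem length_dyadicTimes (n : ℕ) : (dyadicTimes n).length = n * 2 ^ n + 1 := by
  simp [dyadicTimes]

/-- The `k`-th dyadic grid point is `k / 2ⁿ`. [folklore] -/
theorem getElem_dyadicTimes (n : ℕ) {k : ℕ} (hk : k < (dyadicTimes n).length) :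
    (dyadicTimes n)[k] = (k : ℝ≥0) / 2 ^ n := by
  simp [dyadicTimes]

/-- The dyadic grid is strictly increasing. [folklore] -/
theorem sortedLT_dyadicTimes (n : ℕ) : (dyadicTimes n).SortedLT := by
  rw [List.sortedLT_iff_getElem_lt_getElem_of_lt]
  intro i j hi hj hij
  rw [getElem_dyadicTimes n hi, getElem_dyadicTimes n hj]
  exact div_lt_div_of_pos_right (by exact_mod_cast hij) (pow_pos two_pos n)

/-! ### Clamping -/

/-- `clamp C x = max (-C) (min C x)`: the value `x` clamped to `[-C, C]` (for `C ≥ 0`). [folklore] -/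
def clamp (C x : ℝ) : ℝ := max (-C) (min C x)

/-- Clamped values are bounded by `|C|`. [folklore] -/
theorem abs_clamp_le (C x : ℝ) : |clamp C x| ≤ |C| := by
  unfold clamp
  rcases le_or_gt 0 C with hC | hC
  · rw [abs_of_nonneg hC, abs_le]
    exact ⟨le_max_left _ _, max_le (by linarith) (min_le_left _ _)⟩
  · have : max (-C) (min C x) = -C := max_eq_left ((min_le_left _ _).trans (by linarith))
    rw [this, abs_neg]

/-- Clamping at a level above `|x|` does nothing. [folklore] -/
theorem clamp_eq_self {C x : ℝ} (h : |x| ≤ C) : clamp C x = x := by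
  unfold clamp
  rw [abs_le] at h
  rw [min_eq_right h.2, max_eq_right h.1]

/-- Clamping (at a nonnegative level) does not increase the absolute value. [folklore] -/
theorem abs_clamp_le_abs {C : ℝ} (hC : 0 ≤ C) (x : ℝ) : |clamp C x| ≤ |x| := by
  unfold clamp
  rcases le_total x C with hxC | hxC
  · rw [min_eq_right hxC]
    rcases le_total (-C) x with hCx | hCx
    · rw [max_eq_right hCx]
    · rw [max_eq_left hCx, abs_of_nonpos (by linarith), abs_of_nonpos (by linarith)]
      linarith
  · rw [min_eq_left hxC, max_eq_right (by linarith), abs_of_nonneg hC, abs_of_nonneg (by linarith)]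
    exact hxC

/-- `clamp C` is continuous. [folklore] -/
theorem continuous_clamp (C : ℝ) : Continuous (clamp C) :=
  continuous_const.max (continuous_const.min continuous_id)

namespace SimpleProcess

/-! ### A step process on its partition intervals -/

/-- On the `k`-th partition interval `(t_k, t_{k+1}]` the step process equals the `k`-th value.
Revuz–Yor, *Continuous Martingales and Brownian Motion* (1999), Ch. IV, Def. (2.3). [folklore] -/
theorem toProcess_eq_value_of_mem_Ioc (H : SimpleProcess m 𝓕) {k : ℕ} (hk : k + 1 < H.times.length)
    {s : ℝ≥0} (hs : s ∈ Set.Ioc (H.time k) (H.time (k + 1))) (ω : Ω) :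
    H.toProcess s ω = H.value k ω := by
  unfold toProcess
  have hk' : k ∈ range (H.times.length - 1) := mem_range.2 (by omega)
  rw [sum_eq_single k (fun i hi hik ↦ Set.indicator_of_notMem
      (H.not_mem_Ioc_of_mem_Ioc (by have := mem_range.1 hi; omega) hk hik hs) _)
      (fun h ↦ (h hk').elim), Set.indicator_of_mem hs]

/-- Outside `(t₀, t_last]` the step process vanishes; in particular for `s` beyond the last
partition time. [folklore] -/
theorem toProcess_eq_zero_of_forall (H : SimpleProcess m 𝓕) {s : ℝ≥0}
    (hs : ∀ i, i + 1 < H.times.length → s ∉ Set.Ioc (H.time i) (H.time (i + 1))) (ω : Ω) :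
    H.toProcess s ω = 0 := by
  unfold toProcess
  exact sum_eq_zero fun i hi ↦ Set.indicator_of_notMem (hs i (by have := mem_range.1 hi; omega)) _

/-- **Joint measurability of step processes**: `(ω, s) ↦ H(s⁺, ω)` is measurable on `Ω × ℝ`
(the values in range are measurable, the partition is deterministic). [folklore] -/
theorem measurable_toProcess_prod (H : SimpleProcess m 𝓕) :
    Measurable fun p : Ω × ℝ ↦ H.toProcess p.2.toNNReal p.1 := by
  unfold toProcess
  refine Finset.measurable_sum _ fun i hi ↦ ?_
  have hi' : i < H.times.length := by have := mem_range.1 hi; omega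
  -- `indicator (Ioc tᵢ tᵢ₊₁) (fun _ ↦ Hᵢ ω) (s⁺) = 1_{s⁺ ∈ Ioc} * Hᵢ ω`
  have heq : (fun p : Ω × ℝ ↦ (Set.Ioc (H.time i) (H.time (i + 1))).indicator
      (fun _ ↦ H.value i p.1) p.2.toNNReal) =
      fun p ↦ (Set.Ioc (H.time i) (H.time (i + 1))).indicator (fun _ ↦ (1 : ℝ)) p.2.toNNReal *
        H.value i p.1 := by
    ext p
    by_cases h : p.2.toNNReal ∈ Set.Ioc (H.time i) (H.time (i + 1))
    · simp [Set.indicator_of_mem h]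
    · simp [Set.indicator_of_notMem h]
  rw [heq]
  exact (((measurable_const.indicator measurableSet_Ioc).comp
    (measurable_real_toNNReal.comp measurable_snd))).mul
    ((H.stronglyMeasurable_value' hi').measurable.comp measurable_fst)

/-! ### Dyadic sampling of an adapted integrand -/

section Sample

variable (σ : ℝ≥0 → Ω → ℝ) (hσ : Adapted 𝓕 σ)

/-- **Dyadic sampling** of an adapted integrand `σ`: the bounded simple process with the
dyadic partition `k / 2ⁿ`, `k ≤ n 2ⁿ`, whose value on `(k/2ⁿ, (k+1)/2ⁿ]` is `σ_{k/2ⁿ}` clamped to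
`[-n, n]` — the elementary processes `∑ K_{tᵢ} 1_{]tᵢ, tᵢ₊₁]}` of Revuz–Yor's proof of
Prop. (2.13), truncated to be bounded.
Revuz–Yor, *Continuous Martingales and Brownian Motion* (1999), Ch. IV, Prop. (2.13).
[folklore] -/
def sample (n : ℕ) : SimpleProcess m 𝓕 where
  times := dyadicTimes n
  sorted := sortedLT_dyadicTimes n
  value k ω := clamp n (σ ((k : ℝ≥0) / 2 ^ n) ω)
  measurable k hk := by
    have heq : (dyadicTimes n).get ⟨k, hk⟩ = (k : ℝ≥0) / 2 ^ n := getElem_dyadicTimes n hk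
    rw [heq]
    exact ((continuous_clamp n).measurable.comp (hσ _)).stronglyMeasurable
  bounded := ⟨|(n : ℝ)|, fun k ω ↦ abs_clamp_le _ _⟩

/-- The partition of the sampled process is the dyadic grid. [folklore] -/
@[simp] theorem sample_times (n : ℕ) : (sample σ hσ n).times = dyadicTimes n := rfl

/-- The partition times of the sampled process, in range. [folklore] -/
theorem sample_time (n : ℕ) {k : ℕ} (hk : k < n * 2 ^ n + 1) :
    (sample σ hσ n).time k = (k : ℝ≥0) / 2 ^ n := by
  rw [time_eq_getElem _ (by simpa using hk)]
  exact getElem_dyadicTimes n _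

/-- The values of the sampled process. [folklore] -/
theorem sample_value (n k : ℕ) (ω : Ω) :
    (sample σ hσ n).value k ω = clamp n (σ ((k : ℝ≥0) / 2 ^ n) ω) := rfl

end Sample

end SimpleProcess

/-- **The left end of the dyadic sampling cell**: for `s > 0` the partition cell of the dyadic
grid of mesh `2⁻ⁿ` containing `s` is the *left-open* interval `(k/2ⁿ, (k+1)/2ⁿ]` with
`k = ⌈s 2ⁿ⌉ - 1`, and `sampleLeft n s = k / 2ⁿ` is its left end point — the time at which `σ` is
read by `SimpleProcess.sample` on that cell. (This is `⌈s 2ⁿ⌉ - 1`, not the dyadic floor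
`⌊s 2ⁿ⌋` of `Literature.Analysis.FunctionSpaces.dyadicFloor`: the two differ exactly at grid points `s = k/2ⁿ`, which belong to
the cell on their left because cells are left-open.)
Revuz–Yor, *Continuous Martingales and Brownian Motion* (1999), Ch. IV, Prop. (2.13). [folklore] -/
def sampleLeft (n : ℕ) (s : ℝ≥0) : ℝ≥0 := ((⌈(s : ℝ) * 2 ^ n⌉₊ - 1 : ℕ) : ℝ≥0) / 2 ^ n

/-- The left end of the sampling cell, as a real number. [folklore] -/
theorem coe_sampleLeft (n : ℕ) (s : ℝ≥0) :
    (sampleLeft n s : ℝ) = ((⌈(s : ℝ) * 2 ^ n⌉₊ - 1 : ℕ) : ℝ) / 2 ^ n := by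
  simp only [sampleLeft, NNReal.coe_div, NNReal.coe_natCast, NNReal.coe_pow, NNReal.coe_ofNat]

/-- The left end of the sampling cell of `s > 0` is `≤ s` and within `2⁻ⁿ` of `s`. [folklore] -/
theorem sampleLeft_le_and_sub_le {n : ℕ} {s : ℝ≥0} (hs0 : 0 < s) :
    sampleLeft n s ≤ s ∧ (s : ℝ) - sampleLeft n s ≤ 1 / 2 ^ n := by
  have h2 : (0 : ℝ) < 2 ^ n := pow_pos two_pos n
  have hs2 : 0 < (s : ℝ) * 2 ^ n := mul_pos (by exact_mod_cast hs0) h2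
  have hceil : 1 ≤ ⌈(s : ℝ) * 2 ^ n⌉₊ := Nat.one_le_iff_ne_zero.2 (Nat.ceil_pos.2 hs2).ne'
  have hcast : ((⌈(s : ℝ) * 2 ^ n⌉₊ - 1 : ℕ) : ℝ) = (⌈(s : ℝ) * 2 ^ n⌉₊ : ℝ) - 1 := by
    rw [Nat.cast_sub hceil, Nat.cast_one]
  have hlt := Nat.ceil_lt_add_one hs2.le
  have hle := Nat.le_ceil ((s : ℝ) * 2 ^ n)
  have hcoe : (sampleLeft n s : ℝ) = ((⌈(s : ℝ) * 2 ^ n⌉₊ : ℝ) - 1) / 2 ^ n := by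
    rw [coe_sampleLeft, hcast]
  constructor
  · rw [← NNReal.coe_le_coe, hcoe, div_le_iff₀ h2]; linarith
  · rw [hcoe, sub_le_iff_le_add, ← add_div, le_div_iff₀ h2]; linarith

/-- The left end of the sampling cell of `s > 0` is `≤ s`. [folklore] -/
theorem sampleLeft_le {n : ℕ} {s : ℝ≥0} (hs0 : 0 < s) : sampleLeft n s ≤ s :=
  (sampleLeft_le_and_sub_le hs0).1

namespace SimpleProcess

section Sample

variable (σ : ℝ≥0 → Ω → ℝ) (hσ : Adapted 𝓕 σ)

/-- **The sampled step process on `(0, n]`**: for `0 < s ≤ n` the sampled process at `s` is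
`clamp n (σ_{sampleLeft n s})`, the clamped value of `σ` at the left end of the dyadic cell
`(k/2ⁿ, (k+1)/2ⁿ] ∋ s`, `k = ⌈s 2ⁿ⌉ - 1`. [folklore] -/
theorem toProcess_sample {n : ℕ} {s : ℝ≥0} (hs0 : 0 < s) (hsn : s ≤ n) (ω : Ω) :
    (sample σ hσ n).toProcess s ω = clamp n (σ (sampleLeft n s) ω) := by
  set k : ℕ := ⌈(s : ℝ) * 2 ^ n⌉₊ - 1 with hk
  have h2 : (0 : ℝ) < 2 ^ n := pow_pos two_pos n
  have hs2 : 0 < (s : ℝ) * 2 ^ n := mul_pos (by exact_mod_cast hs0) h2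
  have hceil : 1 ≤ ⌈(s : ℝ) * 2 ^ n⌉₊ := Nat.one_le_iff_ne_zero.2 (Nat.ceil_pos.2 hs2).ne'
  have hk1 : k + 1 = ⌈(s : ℝ) * 2 ^ n⌉₊ := by omega
  have hkle : k + 1 ≤ n * 2 ^ n := by
    rw [hk1]
    refine Nat.ceil_le.2 ?_
    have : (s : ℝ) ≤ n := by exact_mod_cast hsn
    push_cast
    nlinarith
  have hklen : k + 1 < (sample σ hσ n).times.length := by
    simp only [sample_times, length_dyadicTimes]; omega
  rw [toProcess_eq_value_of_mem_Ioc _ hklen ?_ ω, sample_value]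
  · rfl
  -- `s ∈ (k/2ⁿ, (k+1)/2ⁿ]`
  rw [sample_time σ hσ n (by omega), sample_time σ hσ n (by omega)]
  constructor
  · -- `k / 2ⁿ < s` since `k < s 2ⁿ` (`k + 1 = ⌈s 2ⁿ⌉`)
    rw [div_lt_iff₀ (pow_pos two_pos n)]
    have : (k : ℝ) < (s : ℝ) * 2 ^ n := by
      have := Nat.ceil_lt_add_one hs2.le
      rw [← hk1] at this
      push_cast at this
      linarith
    exact_mod_cast this
  · -- `s ≤ (k+1) / 2ⁿ` since `s 2ⁿ ≤ ⌈s 2ⁿ⌉`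
    rw [le_div_iff₀ (pow_pos two_pos n)]
    have : (s : ℝ) * 2 ^ n ≤ ((k + 1 : ℕ) : ℝ) := by
      rw [hk1]; exact Nat.le_ceil _
    exact_mod_cast this

/-- **The sampled step process is dominated by the sampled integrand**: for `0 < s ≤ n`,
`|σₙ(s, ω)| ≤ |σ(sampleLeft n s, ω)|`. [folklore] -/
theorem abs_toProcess_sample_le {n : ℕ} {s : ℝ≥0} (hs0 : 0 < s) (hsn : s ≤ n) (ω : Ω) :
    |(sample σ hσ n).toProcess s ω| ≤ |σ (sampleLeft n s) ω| := by
  rw [toProcess_sample σ hσ hs0 hsn]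
  exact abs_clamp_le_abs (Nat.cast_nonneg n) _

/-- **Pathwise approximation by dyadic sampling**: if the path `s ↦ σ s ω` is continuous, the
time integrals `∫₀ᵗ (σₙ(s⁺, ω) - σ(s⁺, ω))² ds` of the sampling error tend to `0`
(`σₙ = sample σ hσ n`; the integral is the extended Lebesgue integral over `[0, t] ⊆ ℝ`, as in
`SimpleProcess.IsApproxSeq`). Uniform continuity of the path on `[0, t]`; for `n ≥ sup |σ|` the
clamping is inactive.
Revuz–Yor, *Continuous Martingales and Brownian Motion* (1999), Ch. IV, proof of Prop. (2.13)
("the elementary processes … converge pointwise to `K`"). [folklore] -/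
theorem tendsto_lintegral_sample_sub_sq {ω : Ω} (hω : Continuous (σ · ω)) (t : ℝ≥0) :
    Tendsto (fun n ↦ ∫⁻ s in Set.Icc (0 : ℝ) t,
      ENNReal.ofReal (((sample σ hσ n).toProcess s.toNNReal ω - σ s.toNNReal ω) ^ 2))
      atTop (𝓝 0) := by
  rw [ENNReal.tendsto_nhds_zero]
  intro e he
  -- reduce to a real target `e' > 0` with `ofReal (e'² t) ≤ e`... choose `e'` with `e'^2 * t ≤ e`
  -- Step 0: a bound for `|σ|` on `[0, t]` and uniform continuity there
  set f : ℝ≥0 → ℝ := fun s ↦ σ s ω with hf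
  have hfc : Continuous f := hω
  obtain ⟨C, hC⟩ := (isCompact_Icc (a := (0 : ℝ≥0)) (b := t)).exists_bound_of_continuousOn
    hfc.continuousOn
  -- target accuracy
  obtain ⟨e', he', hee'⟩ : ∃ e' : ℝ, 0 < e' ∧ ENNReal.ofReal (e' ^ 2 * t) ≤ e := by
    rcases eq_or_ne e ⊤ with rfl | hetop
    · exact ⟨1, one_pos, le_top⟩
    have hepos : 0 < e.toReal := ENNReal.toReal_pos he.ne' hetop
    refine ⟨Real.sqrt (e.toReal / (t + 1)), Real.sqrt_pos.2 (by positivity), ?_⟩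
    rw [Real.sq_sqrt (by positivity)]
    calc ENNReal.ofReal (e.toReal / (t + 1) * t) ≤ ENNReal.ofReal e.toReal := by
          refine ENNReal.ofReal_le_ofReal ?_
          rw [div_mul_eq_mul_div, div_le_iff₀ (by positivity)]
          nlinarith [t.2]
      _ = e := ENNReal.ofReal_toReal hetop
  obtain ⟨δ, hδ, hδf⟩ := Metric.uniformContinuousOn_iff.1
    ((isCompact_Icc (a := (0 : ℝ≥0)) (b := t)).uniformContinuousOn_of_continuous hfc.continuousOn)
    e' he'
  -- Step 1: choose `N` with `N ≥ t`, `N ≥ C`, `2⁻ᴺ < δ`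
  obtain ⟨N₁, hN₁⟩ := exists_nat_ge (max (t : ℝ) C)
  obtain ⟨N₂, hN₂⟩ : ∃ N : ℕ, (1 : ℝ) / 2 ^ N < δ := by
    obtain ⟨N, hN⟩ := exists_pow_lt_of_lt_one hδ (by norm_num : (1 : ℝ) / 2 < 1)
    exact ⟨N, by rwa [one_div, ← inv_pow, ← one_div]⟩
  refine eventually_atTop.2 ⟨max N₁ N₂, fun n hn ↦ ?_⟩
  have hnt : (t : ℝ) ≤ n := ((le_max_left _ _).trans hN₁).trans (by exact_mod_cast le_of_max_le_left hn)
  have hnC : C ≤ n := ((le_max_right _ _).trans hN₁).trans (by exact_mod_cast le_of_max_le_left hn)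
  have hnδ : (1 : ℝ) / 2 ^ n < δ := by
    refine lt_of_le_of_lt ?_ hN₂
    exact one_div_le_one_div_of_le (pow_pos two_pos _)
      (pow_le_pow_right₀ one_le_two (le_of_max_le_right hn))
  -- Step 2: pointwise bound of the integrand on `(0, t]`
  have hbound : ∀ s ∈ Set.Ioc (0 : ℝ) t,
      ENNReal.ofReal (((sample σ hσ n).toProcess s.toNNReal ω - σ s.toNNReal ω) ^ 2) ≤
        ENNReal.ofReal (e' ^ 2) := by
    intro s hs
    have hs0 : 0 < s.toNNReal := Real.toNNReal_pos.2 hs.1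
    have hst : s.toNNReal ≤ t := Real.toNNReal_le_iff_le_coe.2 hs.2
    have hsn : s.toNNReal ≤ n := by
      have : (s.toNNReal : ℝ) ≤ n := (NNReal.coe_le_coe.2 hst).trans hnt
      exact_mod_cast this
    rw [toProcess_sample σ hσ hs0 hsn]
    set u : ℝ≥0 := sampleLeft n s.toNNReal with hu
    obtain ⟨hus, hu2⟩ := sampleLeft_le_and_sub_le (n := n) hs0
    have hut : u ∈ Set.Icc (0 : ℝ≥0) t := ⟨zero_le, hus.trans hst⟩
    have hsIcc : s.toNNReal ∈ Set.Icc (0 : ℝ≥0) t := ⟨zero_le, hst⟩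
    -- clamping is inactive
    have hclamp : clamp n (σ u ω) = σ u ω :=
      clamp_eq_self ((Real.norm_eq_abs _ ▸ hC u hut).trans hnC)
    rw [hclamp]
    refine ENNReal.ofReal_le_ofReal ?_
    have hdist : dist u s.toNNReal < δ := by
      rw [NNReal.dist_eq, abs_sub_comm, abs_of_nonneg (by rw [sub_nonneg]; exact_mod_cast hus)]
      exact hu2.trans_lt hnδ
    have := hδf u hut s.toNNReal hsIcc hdist
    rw [Real.dist_eq] at this
    have habs : |σ u ω - σ s.toNNReal ω| < e' := this
    nlinarith [abs_nonneg (σ u ω - σ s.toNNReal ω), sq_abs (σ u ω - σ s.toNNReal ω)]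
  -- Step 3: integrate (the point `s = 0` is negligible)
  calc ∫⁻ s in Set.Icc (0 : ℝ) t,
        ENNReal.ofReal (((sample σ hσ n).toProcess s.toNNReal ω - σ s.toNNReal ω) ^ 2)
      = ∫⁻ s in Set.Ioc (0 : ℝ) t,
        ENNReal.ofReal (((sample σ hσ n).toProcess s.toNNReal ω - σ s.toNNReal ω) ^ 2) := by
        rw [← Measure.restrict_congr_set (Ioc_ae_eq_Icc (α := ℝ))]
    _ ≤ ∫⁻ _ in Set.Ioc (0 : ℝ) t, ENNReal.ofReal (e' ^ 2) :=
        setLIntegral_mono measurable_const hbound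
    _ = ENNReal.ofReal (e' ^ 2) * ENNReal.ofReal t := by
        rw [setLIntegral_const, Real.volume_Ioc, sub_zero]
    _ = ENNReal.ofReal (e' ^ 2 * t) := by rw [← ENNReal.ofReal_mul (sq_nonneg _)]
    _ ≤ e := hee'

end Sample

end SimpleProcess

end Literature.Probability.Process
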